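import Literature.MathematicalPhysics.QuantumLattice.GrassmannRelabelling
import HarnessLib

/-!
# Linear substitutions of the generators of a finite Grassmann algebra (`Δ_C`, `μ_C ⋆`, `effAction`, kernels)

Topic `MathematicalPhysics/QuantumLattice`; common generalisation of `GrassmannRelabelling.lean`
(bijective relabellings) and `GrassmannChargeScaling.lean` (diagonal rescalings by units).  For an
ARBITRARY `R`-linear map `f : (Γ → R) →ₗ[R] (Γ' → R)` of generator spaces — matrix
`M = LinearMap.toMatrix' f`, so that the induced algebra homomorphism is the substitution
`ψ(X) ↦ Σ_{X'} M(X', X) ψ'(X')` (`map_gen_eq_sum`) — every layer of Salmhofer's operator calculus is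
COVARIANT, with the covariance PULLED BACK along `f` as a bilinear form, `C' ↦ Mᵀ C' M`:

* `grassmannDeriv_map` — the chain rule `∂_{Y'} (F ∘ f) = Σ_Y M(Y', Y) · (∂_Y F) ∘ f`;
* `iterDeriv_map`, **`kernel_map`** — kernels push forward by the tensor powers of `M`:
  `kernel (map f F) m X' = Σ_X (∏ᵢ M(X'ᵢ, Xᵢ)) kernel F m X`;
* **`grassmannLaplacian_map`**, `gaussConv_map` — `Δ_{C'} (map f a) = map f (Δ_{Mᵀ C' M} a)` and the same
  for `μ ⋆ = e^{Δ}`;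
* `isNilpotent_iff_isNilpotent_constPart`, `isNilpotent_map_iff`, **`map_grassmannExp_eq`**,
  **`map_grassmannLog1p`** — substitutions commute with the truncated exponential and logarithm for
  EVERY element (no injectivity: nilpotency is read off the constant part, which `map f` preserves);
* `effBoltzmann_map`, `effPartitionFn_map`, **`effAction_map`** —
  `effAction C' (map f V) = map f (effAction (Mᵀ C' M) V)`: a Gaussian Grassmann integral in the
  variables `ψ'` with covariance `C'`, of a function of the linear combinations `ψ = Mᵀ ψ'`, is the
  Gaussian integral in `ψ` with covariance `Mᵀ C' M` (Berezin 1966, Ch. I §3; Salmhofer 1999,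
  (B.23)–(B.25) and §4.3; BGM 2006, (2.12) and §2.5 where the field is split into independent
  quasi-particle / sector fields `ψ = Σ_ω ψ_ω`).

Corollaries (the two shapes the multiscale expansion uses):

* **field splitting / Gaussian addition** (`map_funLeft_fst_gen`, `kernel_map_funLeft_fst`,
  `gaussConv_fieldSum`, **`effAction_fieldSum`**): for the substitution `ψ(X) ↦ Σ_s ψ'(X, s)` into `|S|`
  copies of the fields and ANY covariance `C'` of the copies,
  `effAction C' (V(Σ_s ψ'_s)) = (effAction (Σ_{s,s'} C'_{s s'}) V)(Σ_s ψ'_s)` — for block-diagonal `C'`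
  this is `∫ P_{Σ_s C_s}(dψ) F(ψ) = ∫ ∏_s P_{C_s}(dψ_s) F(Σ_s ψ_s)` at the level of effective actions;
* **dead variables / general diagonal rescalings** (`effAction_map_mulLeft_of_covariance`): for any
  weight `c : Γ → R` with `c(X) c(Y) C(X,Y) = C(X,Y)` (e.g. the indicator of a set of labels off which
  `C` vanishes), `effAction C (S_c V) = S_c (effAction C V)` — without the unit hypothesis of
  `GrassmannChargeScaling.effAction_map_mulLeft`.

Everything is proved; no definitions, no named facts.

## Sources

F. A. Berezin, *The Method of Second Quantization* (1966), Ch. I §3 [`Berezin1966`]; M. Salmhofer,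
*Renormalization* (1999), App. B.2 (B.23)–(B.25), §4.3 (4.86)–(4.88) [`Salmhofer1999`]; G. Benfatto,
A. Giuliani, V. Mastropietro, Ann. Henri Poincaré 7 (2006) 809–898, (2.12), §2.5 (2.44)–(2.48)
[`BenfattoGiulianiMastropietro2006`].  All statements are routine ("folklore").
-/

noncomputable section

namespace Literature.MathematicalPhysics.QuantumLattice

open GrassmannAlgebra Finset

section LinearSubstitution

variable (R : Type*) [CommRing R] {Γ Γ' : Type*} [Fintype Γ] [DecidableEq Γ]

/-- The matrix of `f` acts on coordinates: `(f v)(X') = Σ_X M(X', X) v(X)`. [folklore] -/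
theorem apply_eq_sum_toMatrix' (f : (Γ → R) →ₗ[R] (Γ' → R)) (v : Γ → R) (X' : Γ') :
    f v X' = ∑ X, LinearMap.toMatrix' f X' X * v X := by
  conv_lhs => rw [← Matrix.toLin'_toMatrix' f, Matrix.toLin'_apply]
  rfl

/-- **A linear substitution acts on generators by `ψ(X) ↦ Σ_{X'} M(X', X) ψ'(X')`.** [folklore] -/
theorem map_gen_eq_sum [Fintype Γ'] [DecidableEq Γ'] (f : (Γ → R) →ₗ[R] (Γ' → R)) (X : Γ) :
    ExteriorAlgebra.map f (gen R X) = ∑ X', LinearMap.toMatrix' f X' X • gen R X' := by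
  rw [gen, ExteriorAlgebra.map_apply_ι]
  have hv : f (Pi.single X 1) = ∑ X', LinearMap.toMatrix' f X' X • (Pi.single X' (1 : R) : Γ' → R) := by
    ext Y'
    simp [Finset.sum_apply, Pi.single_apply, LinearMap.toMatrix'_apply]
  rw [hv, map_sum]
  simp only [map_smul, gen]

/-- **The chain rule for left derivatives**: `∂_{Y'} (map f a) = Σ_Y M(Y', Y) · map f (∂_Y a)`.
[folklore] -/
theorem grassmannDeriv_map (f : (Γ → R) →ₗ[R] (Γ' → R)) (Y' : Γ') (a : GrassmannAlgebra R Γ) :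
    grassmannDeriv R Y' (ExteriorAlgebra.map f a) =
      ∑ Y, LinearMap.toMatrix' f Y' Y • ExteriorAlgebra.map f (grassmannDeriv R Y a) := by
  induction a using CliffordAlgebra.left_induction with
  | algebraMap r => simp [AlgHom.commutes, grassmannDeriv_algebraMap]
  | add x y hx hy => simp only [map_add, hx, hy, smul_add, Finset.sum_add_distrib]
  | ι_mul x v hx =>
    rw [map_mul, ExteriorAlgebra.map_apply_ι, grassmannDeriv_ι_mul, hx, apply_eq_sum_toMatrix']
    simp only [grassmannDeriv_ι_mul, map_sub, map_smul, map_mul, ExteriorAlgebra.map_apply_ι, smul_sub,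
      Finset.sum_sub_distrib, Finset.mul_sum, mul_smul_comm, smul_smul, Finset.sum_smul]

/-- **Iterated derivatives**: `∂_{X'} (map f a) = Σ_X (∏ᵢ M(X'ᵢ, Xᵢ)) · map f (∂_X a)` (multi-indices of
the same length). [folklore] -/
theorem iterDeriv_map (f : (Γ → R) →ₗ[R] (Γ' → R)) {m : ℕ} (X' : Fin m → Γ') (a : GrassmannAlgebra R Γ) :
    iterDeriv R X' (ExteriorAlgebra.map f a) =
      ∑ X : Fin m → Γ, (∏ i, LinearMap.toMatrix' f (X' i) (X i)) • ExteriorAlgebra.map f (iterDeriv R X a) := by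
  induction m generalizing a with
  | zero => simp [iterDeriv]
  | succ m ih =>
    rw [iterDeriv_succ_apply, grassmannDeriv_map, map_sum]
    simp only [map_smul, ih, Finset.smul_sum, smul_smul]
    rw [← (Fin.consEquiv fun _ => Γ).sum_comp, Fintype.sum_prod_type]
    refine Finset.sum_congr rfl fun Y _ => Finset.sum_congr rfl fun Z _ => ?_
    simp only [Fin.consEquiv, Equiv.coe_fn_mk, Fin.prod_univ_succ, Fin.cons_zero, Fin.cons_succ,
      iterDeriv_succ_apply R (Fin.cons Y Z : Fin (m + 1) → Γ)]

variable [Algebra ℚ R]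

/-- **Kernels of a substituted element**: `kernel (map f F) m X' = Σ_X (∏ᵢ M(X'ᵢ, Xᵢ)) · kernel F m X` —
the kernels push forward by the tensor powers of the substitution matrix. [folklore] -/
theorem kernel_map (f : (Γ → R) →ₗ[R] (Γ' → R)) (F : GrassmannAlgebra R Γ) (m : ℕ) (X' : Fin m → Γ') :
    kernel R (ExteriorAlgebra.map f F) m X' =
      ∑ X : Fin m → Γ, (∏ i, LinearMap.toMatrix' f (X' i) (X i)) * kernel R F m X := by
  rw [kernel, iterDeriv_map, map_sum, Finset.mul_sum]
  refine Finset.sum_congr rfl fun X _ => ?_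
  rw [map_smul, constPart_map, kernel, smul_eq_mul]
  ring

variable [Fintype Γ']

omit [Fintype Γ] [DecidableEq Γ] [Algebra ℚ R] [Fintype Γ'] in
/-- Reordering a quadruple sum: `Σ_a Σ_b Σ_c Σ_d = Σ_c Σ_d Σ_a Σ_b`. [folklore] -/
theorem sum_sum_sum_sum_comm {M : Type*} [AddCommMonoid M] {α β γ δ : Type*} [Fintype α] [Fintype β]
    [Fintype γ] [Fintype δ] (g : α → β → γ → δ → M) :
    ∑ a, ∑ b, ∑ c, ∑ d, g a b c d = ∑ c, ∑ d, ∑ a, ∑ b, g a b c d := by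
  calc ∑ a, ∑ b, ∑ c, ∑ d, g a b c d = ∑ a, ∑ c, ∑ b, ∑ d, g a b c d :=
        Finset.sum_congr rfl fun a _ => Finset.sum_comm
    _ = ∑ c, ∑ a, ∑ b, ∑ d, g a b c d := Finset.sum_comm
    _ = ∑ c, ∑ a, ∑ d, ∑ b, g a b c d :=
        Finset.sum_congr rfl fun c _ => Finset.sum_congr rfl fun a _ => Finset.sum_comm
    _ = ∑ c, ∑ d, ∑ a, ∑ b, g a b c d := Finset.sum_congr rfl fun c _ => Finset.sum_comm

/-- **The fermionic Laplacian is covariant**: `Δ_{C'} (map f a) = map f (Δ_{Mᵀ C' M} a)` — the covariance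
pulls back as a bilinear form. [folklore] -/
theorem grassmannLaplacian_map (f : (Γ → R) →ₗ[R] (Γ' → R)) (C' : Matrix Γ' Γ' R) (a : GrassmannAlgebra R Γ) :
    grassmannLaplacian R C' (ExteriorAlgebra.map f a) =
      ExteriorAlgebra.map f
        (grassmannLaplacian R ((LinearMap.toMatrix' f).transpose * C' * LinearMap.toMatrix' f) a) := by
  rw [grassmannLaplacian_apply, grassmannLaplacian_apply, map_smul, map_sum]
  congr 1
  -- expand both sides into a quadruple sum over `X', Y', X, Y`
  have hL : ∀ X' Y' : Γ', C' X' Y' • grassmannDeriv R X' (grassmannDeriv R Y' (ExteriorAlgebra.map f a)) =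
      ∑ X, ∑ Y, (LinearMap.toMatrix' f X' X * C' X' Y' * LinearMap.toMatrix' f Y' Y) •
        ExteriorAlgebra.map f (grassmannDeriv R X (grassmannDeriv R Y a)) := by
    intro X' Y'
    rw [grassmannDeriv_map, map_sum, Finset.smul_sum, Finset.sum_comm]
    refine Finset.sum_congr rfl fun Y _ => ?_
    rw [map_smul, grassmannDeriv_map, Finset.smul_sum, Finset.smul_sum]
    refine Finset.sum_congr rfl fun X _ => ?_
    rw [smul_smul, smul_smul]
    congr 1
    ring
  have hR : ∀ X : Γ, ExteriorAlgebra.map f (∑ Y, ((LinearMap.toMatrix' f).transpose * C' *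
      LinearMap.toMatrix' f) X Y • grassmannDeriv R X (grassmannDeriv R Y a)) =
      ∑ Y, ∑ X', ∑ Y', (LinearMap.toMatrix' f X' X * C' X' Y' * LinearMap.toMatrix' f Y' Y) •
        ExteriorAlgebra.map f (grassmannDeriv R X (grassmannDeriv R Y a)) := by
    intro X
    rw [map_sum]
    refine Finset.sum_congr rfl fun Y _ => ?_
    rw [map_smul, Matrix.mul_apply]
    simp only [Matrix.mul_apply, Matrix.transpose_apply, Finset.sum_mul, Finset.sum_smul]
    rw [Finset.sum_comm]
  simp only [hL, hR]
  -- both sides are now `Σ_{X'} Σ_{Y'} Σ_X Σ_Y` vs `Σ_X Σ_Y Σ_{X'} Σ_{Y'}` of the same summand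
  exact sum_sum_sum_sum_comm _

/-- Powers of the Laplacian are covariant. [folklore] -/
theorem grassmannLaplacian_pow_map (f : (Γ → R) →ₗ[R] (Γ' → R)) (C' : Matrix Γ' Γ' R) (k : ℕ)
    (a : GrassmannAlgebra R Γ) :
    (grassmannLaplacian R C' ^ k) (ExteriorAlgebra.map f a) =
      ExteriorAlgebra.map f
        ((grassmannLaplacian R ((LinearMap.toMatrix' f).transpose * C' * LinearMap.toMatrix' f) ^ k) a) := by
  induction k generalizing a with
  | zero => simp
  | succ k ih =>
    rw [pow_succ, pow_succ, Module.End.mul_apply, Module.End.mul_apply, grassmannLaplacian_map, ih]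

/-- **The Gaussian convolution is covariant**: `μ_{C'} ⋆ (map f a) = map f (μ_{Mᵀ C' M} ⋆ a)`
(Salmhofer 1999, (B.23)–(B.25): linear changes of variables in Grassmann Gaussian integrals; BGM 2006,
(2.12)). [cite: Salmhofer1999, App. B.2 (B.23)-(B.25)] -/
theorem gaussConv_map (f : (Γ → R) →ₗ[R] (Γ' → R)) (C' : Matrix Γ' Γ' R) (a : GrassmannAlgebra R Γ) :
    gaussConv R C' (ExteriorAlgebra.map f a) =
      ExteriorAlgebra.map f
        (gaussConv R ((LinearMap.toMatrix' f).transpose * C' * LinearMap.toMatrix' f) a) := by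
  set C := (LinearMap.toMatrix' f).transpose * C' * LinearMap.toMatrix' f
  obtain ⟨k₁, hk₁⟩ := isNilpotent_grassmannLaplacian R C'
  obtain ⟨k₂, hk₂⟩ := isNilpotent_grassmannLaplacian R C
  have h₁ : grassmannLaplacian R C' ^ (k₁ + k₂) = 0 := by rw [pow_add, hk₁, zero_mul]
  have h₂ : grassmannLaplacian R C ^ (k₁ + k₂) = 0 := by rw [pow_add, hk₂, mul_zero]
  rw [gaussConv, gaussConv, IsNilpotent.exp_eq_sum h₁, IsNilpotent.exp_eq_sum h₂]
  simp only [LinearMap.coe_sum, Finset.sum_apply, LinearMap.smul_apply, map_sum, map_rat_smul,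
    grassmannLaplacian_pow_map, C]

/-! ### Nilpotency is read off the constant part; `exp` and `log` commute with every substitution -/

omit [DecidableEq Γ] [Fintype Γ'] [Algebra ℚ R] in
/-- **An element of a finite Grassmann algebra is nilpotent iff its constant part is.** [folklore] -/
theorem isNilpotent_iff_isNilpotent_constPart (a : GrassmannAlgebra R Γ) :
    IsNilpotent a ↔ IsNilpotent (constPart R a) := by
  refine ⟨fun h => h.map (constPart R), fun h => ?_⟩
  have hn : IsNilpotent (a - algebraMap R _ (constPart R a)) :=
    isNilpotent_of_constPart_eq_zero R (by rw [map_sub, constPart_algebraMap, sub_self])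
  have hc : IsNilpotent (algebraMap R (GrassmannAlgebra R Γ) (constPart R a)) := h.map _
  have := Commute.isNilpotent_add (Algebra.commutes _ _) hc hn
  rwa [add_sub_cancel] at this

omit [DecidableEq Γ] [Algebra ℚ R] in
/-- Substitutions preserve and reflect nilpotency. [folklore] -/
theorem isNilpotent_map_iff (f : (Γ → R) →ₗ[R] (Γ' → R)) (a : GrassmannAlgebra R Γ) :
    IsNilpotent (ExteriorAlgebra.map f a) ↔ IsNilpotent a := by
  rw [isNilpotent_iff_isNilpotent_constPart, constPart_map, ← isNilpotent_iff_isNilpotent_constPart]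

omit [Fintype Γ] [DecidableEq Γ] [Fintype Γ'] [Algebra ℚ R] in
/-- The nilpotency class of a non-nilpotent element is the junk value `0`. [folklore] -/
theorem nilpotencyClass_eq_zero_of_not_isNilpotent {A : Type*} [MonoidWithZero A] {x : A}
    (hx : ¬IsNilpotent x) : nilpotencyClass x = 0 := by
  by_contra h0
  exact hx (isNilpotent_of_pos_nilpotencyClass (Nat.pos_of_ne_zero h0))

omit [DecidableEq Γ] in
/-- **Substitutions commute with the exponential**, for every element (nilpotent or not).
[folklore] -/
theorem map_grassmannExp_eq (f : (Γ → R) →ₗ[R] (Γ' → R)) (a : GrassmannAlgebra R Γ) :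
    ExteriorAlgebra.map f (grassmannExp a) = grassmannExp (ExteriorAlgebra.map f a) := by
  by_cases ha : IsNilpotent a
  · exact IsNilpotent.map_exp ha _
  · have ha' : ¬IsNilpotent (ExteriorAlgebra.map f a) := fun h => ha ((isNilpotent_map_iff R f a).1 h)
    rw [grassmannExp, grassmannExp, IsNilpotent.exp, IsNilpotent.exp,
      nilpotencyClass_eq_zero_of_not_isNilpotent ha, nilpotencyClass_eq_zero_of_not_isNilpotent ha']
    simp

omit [DecidableEq Γ] in
/-- **Substitutions commute with the logarithm**, for every element. [folklore] -/
theorem map_grassmannLog1p (f : (Γ → R) →ₗ[R] (Γ' → R)) (x : GrassmannAlgebra R Γ) :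
    ExteriorAlgebra.map f (grassmannLog1p R x) = grassmannLog1p R (ExteriorAlgebra.map f x) := by
  by_cases hx : IsNilpotent x
  · have hm : (ExteriorAlgebra.map f x) ^ nilpotencyClass x = 0 := by
      rw [← map_pow, pow_nilpotencyClass hx, map_zero]
    rw [grassmannLog1p_eq_sum R hm, grassmannLog1p, map_sum]
    simp only [map_rat_smul, map_pow]
  · have hx' : ¬IsNilpotent (ExteriorAlgebra.map f x) := fun h => hx ((isNilpotent_map_iff R f x).1 h)
    rw [grassmannLog1p, grassmannLog1p, nilpotencyClass_eq_zero_of_not_isNilpotent hx,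
      nilpotencyClass_eq_zero_of_not_isNilpotent hx']
    simp

/-! ### The effective action -/

/-- The effective Boltzmann factor is covariant: `μ_{C'} ⋆ e^{-map f V} = map f (μ_{Mᵀ C' M} ⋆ e^{-V})`.
[folklore] -/
theorem effBoltzmann_map (f : (Γ → R) →ₗ[R] (Γ' → R)) (C' : Matrix Γ' Γ' R) (V : GrassmannAlgebra R Γ) :
    effBoltzmann R C' (ExteriorAlgebra.map f V) =
      ExteriorAlgebra.map f
        (effBoltzmann R ((LinearMap.toMatrix' f).transpose * C' * LinearMap.toMatrix' f) V) := by
  rw [effBoltzmann, effBoltzmann, ← map_neg, ← map_grassmannExp_eq, gaussConv_map]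

/-- **The normalised partition function is invariant**: `∫ dμ_{C'} e^{-V∘f} = ∫ dμ_{Mᵀ C' M} e^{-V}`.
[folklore] -/
theorem effPartitionFn_map (f : (Γ → R) →ₗ[R] (Γ' → R)) (C' : Matrix Γ' Γ' R) (V : GrassmannAlgebra R Γ) :
    effPartitionFn R C' (ExteriorAlgebra.map f V) =
      effPartitionFn R ((LinearMap.toMatrix' f).transpose * C' * LinearMap.toMatrix' f) V := by
  rw [effPartitionFn, effBoltzmann_map, constPart_map, effPartitionFn]

/-- **The Wilsonian effective action is covariant under every linear substitution of the fields**: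
`effAction C' (map f V) = map f (effAction (Mᵀ C' M) V)` — the Grassmann Gaussian integral with
covariance `C'` of a function of `ψ = Mᵀψ'` is the Gaussian integral in `ψ` with the pulled-back
covariance (Berezin 1966, Ch. I §3; Salmhofer 1999, (B.23)–(B.25), (4.88); BGM 2006, (2.12)).
[cite: Salmhofer1999, App. B.2 (B.23)-(B.25)] -/
theorem effAction_map (f : (Γ → R) →ₗ[R] (Γ' → R)) (C' : Matrix Γ' Γ' R) (V : GrassmannAlgebra R Γ) :
    effAction R C' (ExteriorAlgebra.map f V) =
      ExteriorAlgebra.map f (effAction R ((LinearMap.toMatrix' f).transpose * C' * LinearMap.toMatrix' f) V) := by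
  rw [effAction, effAction, effPartitionFn_map, effBoltzmann_map, map_neg, map_grassmannLog1p, map_sub,
    map_one, map_smul]

/-! ### Corollary 1: diagonal rescalings without units (dead variables) -/

omit [Fintype Γ'] [Algebra ℚ R] in
/-- The matrix of the rescaling `v ↦ c · v` is `diagonal c`. [folklore] -/
theorem toMatrix'_mulLeft (c : Γ → R) : LinearMap.toMatrix' (LinearMap.mulLeft R c) = Matrix.diagonal c := by
  ext X Y
  rw [LinearMap.toMatrix'_apply, LinearMap.mulLeft_apply, Pi.mul_apply, Matrix.diagonal_apply]
  by_cases h : X = Y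
  · subst h; simp
  · rw [Pi.single_eq_of_ne h, mul_zero, if_neg h]

omit [Fintype Γ'] [Algebra ℚ R] in
/-- Pulling back along a diagonal rescaling rescales the covariance entrywise. [folklore] -/
theorem diagonal_transpose_mul_mul_diagonal (c : Γ → R) (C : Matrix Γ Γ R) :
    (Matrix.diagonal c).transpose * C * Matrix.diagonal c = Matrix.of fun X Y => c X * c Y * C X Y := by
  ext X Y
  rw [Matrix.diagonal_transpose, Matrix.mul_diagonal, Matrix.diagonal_mul, Matrix.of_apply]
  ring

omit [Fintype Γ'] in
/-- **`effAction C (S_c V) = S_c (effAction (c ⊗ c · C) V)` for EVERY weight `c`** (no unit hypothesis;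
cf. `GrassmannChargeScaling.effAction_map_mulLeft`). [folklore] -/
theorem effAction_map_mulLeft' (c : Γ → R) (C : Matrix Γ Γ R) (V : GrassmannAlgebra R Γ) :
    effAction R C (ExteriorAlgebra.map (LinearMap.mulLeft R c) V) =
      ExteriorAlgebra.map (LinearMap.mulLeft R c) (effAction R (Matrix.of fun X Y => c X * c Y * C X Y) V) := by
  rw [effAction_map, toMatrix'_mulLeft, diagonal_transpose_mul_mul_diagonal]

omit [Fintype Γ'] in
/-- **Dead variables.** If the covariance is invariant under the weight, `c(X) c(Y) C(X,Y) = C(X,Y)`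
— e.g. `c` the indicator of a set of labels off which every row and column of `C` vanishes, `S_c` the
homomorphism killing the other generators — then `effAction C (S_c V) = S_c (effAction C V)`: generators
not coupled by `C` pass through the integration as spectators and may be set to zero before or after.
[folklore] -/
theorem effAction_map_mulLeft_of_covariance (c : Γ → R) {C : Matrix Γ Γ R}
    (hC : ∀ X Y, c X * c Y * C X Y = C X Y) (V : GrassmannAlgebra R Γ) :
    effAction R C (ExteriorAlgebra.map (LinearMap.mulLeft R c) V) =
      ExteriorAlgebra.map (LinearMap.mulLeft R c) (effAction R C V) := by
  rw [effAction_map_mulLeft']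
  congr 2
  exact Matrix.ext fun X Y => hC X Y

/-! ### Corollary 2: splitting a field into a sum of fields (Gaussian addition for effective actions) -/

variable {S : Type*} [Fintype S]

omit [Fintype Γ'] [Algebra ℚ R] [Fintype S] in
/-- The matrix of the field-sum substitution `v ↦ v ∘ fst`: `M((X, s), X₀) = δ_{X X₀}`. [folklore] -/
theorem toMatrix'_funLeft_fst (p : Γ × S) (X₀ : Γ) :
    LinearMap.toMatrix' (LinearMap.funLeft R R (Prod.fst : Γ × S → Γ)) p X₀ = if p.1 = X₀ then 1 else 0 := by
  rw [LinearMap.toMatrix'_apply, LinearMap.funLeft_apply, Pi.single_apply]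

omit [Fintype Γ'] [Algebra ℚ R] in
/-- Contracting a Kronecker delta in the first component (left factor). [folklore] -/
theorem ite_mul_sum_fst (φ : Γ × S → R) (X : Γ) :
    ∑ p : Γ × S, (if p.1 = X then 1 else 0) * φ p = ∑ s, φ (X, s) := by
  rw [Fintype.sum_prod_type, Finset.sum_comm]
  simp only [ite_mul, one_mul, zero_mul, Finset.sum_ite_eq', Finset.mem_univ, if_true]

omit [Fintype Γ'] [Algebra ℚ R] in
/-- Contracting a Kronecker delta in the first component (right factor). [folklore] -/
theorem sum_mul_ite_fst (φ : Γ × S → R) (Y : Γ) :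
    ∑ q : Γ × S, φ q * (if q.1 = Y then 1 else 0) = ∑ s, φ (Y, s) := by
  rw [Fintype.sum_prod_type, Finset.sum_comm]
  simp only [mul_ite, mul_one, mul_zero, Finset.sum_ite_eq', Finset.mem_univ, if_true]

omit [Fintype Γ'] [Algebra ℚ R] in
/-- **The field-sum substitution is `ψ(X) ↦ Σ_s ψ'(X, s)`.** [folklore] -/
theorem map_funLeft_fst_gen [DecidableEq S] (X : Γ) :
    ExteriorAlgebra.map (LinearMap.funLeft R R (Prod.fst : Γ × S → Γ)) (gen R X) = ∑ s, gen R (X, s) := by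
  rw [map_gen_eq_sum, Fintype.sum_prod_type, Finset.sum_comm]
  simp only [toMatrix'_funLeft_fst, ite_smul, one_smul, zero_smul, Finset.sum_ite_eq', Finset.mem_univ,
    if_true]

omit [Fintype Γ'] [Algebra ℚ R] in
/-- The pulled-back covariance of the field-sum substitution is the sum of all blocks:
`(Mᵀ C' M)(X, Y) = Σ_{s,s'} C'((X,s),(Y,s'))`. [folklore] -/
theorem transpose_mul_mul_funLeft_fst (C' : Matrix (Γ × S) (Γ × S) R) :
    (LinearMap.toMatrix' (LinearMap.funLeft R R (Prod.fst : Γ × S → Γ))).transpose * C' *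
        LinearMap.toMatrix' (LinearMap.funLeft R R (Prod.fst : Γ × S → Γ)) =
      Matrix.of fun X Y => ∑ s, ∑ s', C' (X, s) (Y, s') := by
  ext X Y
  simp only [Matrix.mul_apply, Matrix.transpose_apply, toMatrix'_funLeft_fst, Matrix.of_apply,
    ite_mul_sum_fst, sum_mul_ite_fst]
  exact Finset.sum_comm

omit [Fintype Γ'] [Fintype S] in
/-- **Kernels of `V(Σ_s ψ'_s)` are copies of the kernels of `V`**: `kernel (map f F) m X' = kernel F m (fst ∘ X')`
for every string of copy labels. [folklore] -/
theorem kernel_map_funLeft_fst (F : GrassmannAlgebra R Γ) (m : ℕ) (X' : Fin m → Γ × S) :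
    kernel R (ExteriorAlgebra.map (LinearMap.funLeft R R (Prod.fst : Γ × S → Γ)) F) m X' =
      kernel R F m (Prod.fst ∘ X') := by
  rw [kernel_map, Finset.sum_eq_single (Prod.fst ∘ X')]
  · simp
  · intro X _ hX
    obtain ⟨i, hi⟩ : ∃ i, (X' i).1 ≠ X i := by
      by_contra h
      push Not at h
      exact hX (funext fun i => (h i).symm)
    rw [Finset.prod_eq_zero (Finset.mem_univ i) (by rw [toMatrix'_funLeft_fst, if_neg hi]), zero_mul]
  · exact fun h => (h (Finset.mem_univ _)).elim

omit [Fintype Γ'] in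
/-- **Gaussian addition for the convolution**: `μ_{C'} ⋆ (a(Σ_s ψ'_s)) = (μ_{Σ_{s,s'} C'_{ss'}} ⋆ a)(Σ_s ψ'_s)`.
[cite: Salmhofer1999, §2.5.1 (2.105)] -/
theorem gaussConv_fieldSum (C' : Matrix (Γ × S) (Γ × S) R) (a : GrassmannAlgebra R Γ) :
    gaussConv R C' (ExteriorAlgebra.map (LinearMap.funLeft R R (Prod.fst : Γ × S → Γ)) a) =
      ExteriorAlgebra.map (LinearMap.funLeft R R (Prod.fst : Γ × S → Γ))
        (gaussConv R (Matrix.of fun X Y => ∑ s, ∑ s', C' (X, s) (Y, s')) a) := by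
  rw [gaussConv_map, transpose_mul_mul_funLeft_fst]

omit [Fintype Γ'] in
/-- **Gaussian addition for effective actions** (BGM 2006, (2.12) and §2.5: the field of covariance
`Σ_s C_s` split into independent fields `ψ = Σ_s ψ_s`; here for an arbitrary joint covariance `C'` of
the copies): `effAction C' (V(Σ_s ψ'_s)) = (effAction (Σ_{s,s'} C'_{ss'}) V)(Σ_s ψ'_s)`.
[cite: BenfattoGiulianiMastropietro2006, (2.12)] -/
theorem effAction_fieldSum (C' : Matrix (Γ × S) (Γ × S) R) (V : GrassmannAlgebra R Γ) :
    effAction R C' (ExteriorAlgebra.map (LinearMap.funLeft R R (Prod.fst : Γ × S → Γ)) V) =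
      ExteriorAlgebra.map (LinearMap.funLeft R R (Prod.fst : Γ × S → Γ))
        (effAction R (Matrix.of fun X Y => ∑ s, ∑ s', C' (X, s) (Y, s')) V) := by
  rw [effAction_map, transpose_mul_mul_funLeft_fst]

end LinearSubstitution

end Literature.MathematicalPhysics.QuantumLattice

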